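import Summits.BirchSwinnertonDyer.Rank1Residual.F1Sign2.IntrinsicDeepTwistLawsAtTwoWide
import Summits.BirchSwinnertonDyer.Rank1Residual.F1Sign2.DeepTwistLawsAtTwo
import HarnessLib

/-!
# Cell `bsd-f1-sign2`, DESC-§24: CLASS (a) («no `K_v`-rational 2-torsion») OF THE DEEP-TWIST NÉRON-TYPE LAW AT 2 — Lemma J, Theorem Φ, the repaired intrinsic clause (a), Lemma D (-desc g16, MEMO-desc §24; CANDIDATES-delta DESC v24)

TYPER FILING (cell `bsd-f1-sign2`, seat `-ty` g11; -desc g16 filing ask D-desc-58 (16:54:57Z) «REF1-gated: file `MEMO-desc-data/g16/lean/SketchG16ClassA.lean`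
3dd028bae935b8fd → amended 17:07:40Z to `SketchG16ClassA.lean` b7f7b7278c894989 (+ (TY)(a)-tower row `DeepTwistNeronTypeLawAtTwoClassA`, LEMMA B
`NoTwoTorsionConductorBoundAtTwo`) — rows (Φ) `NoTwoTorsionDeepTwistNeronLawAtTwo`, (J) `NoTwoTorsionJValuationLawAtTwo`, (R) `IntrinsicDeepTwistNeronTypeLawAtTwoClassAOdd` + kernel
glue `…ClassAOdd_of_noTwoTorsion`, (D) `OddGaloisTamagawaTwoPartMonotoneAtTwo`; imports in-tree `IntrinsicDeepTwistLawsAtTwoWide`; lean check rc 0 / 0 sorry;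
BC7 3/3 CLEAN (`lean/ProbeG16ClassA.verdict.txt`); plain defs if D-desc-56 passes else @[conjecture]»; REF1 §131: «typed decls SURVIVE … no action needed beyond D-desc-58 as amended»): the sketch body
b7f7b7278c894989 VERBATIM — same flat namespace `…Rank1Residual.F1Sign2`, two imports (the in-tree `F1Sign2.IntrinsicDeepTwistLawsAtTwoWide`, p644498, which imports
`F1Sign2.IntrinsicDeepTwistLawsAtTwo`, p642939: carriers `ordAt`, `ramificationIdxOverTwo`, `twoTorsionRootCountAt`, `kodairaSymbolAt`, `conductorExponent`; and
`F1Sign2.DeepTwistLawsAtTwo`, p640583: `deepTwist`, `IsTowerStepGenerator`, `twoAdicTwoTorsionRootCount`).  Decls (7): (J) `NoTwoTorsionJValuationLawAtTwo` (LEMMA J, elementary KNOWN-grade support), (Φ) `NoTwoTorsionDeepTwistNeronLawAtTwo` (THEOREM Φ, proved in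
words MEMO-desc §24), (R) `IntrinsicDeepTwistNeronTypeLawAtTwoClassAOdd` (= clause (a) of the in-tree `IntrinsicDeepTwistNeronTypeLawAtTwo` /
`…Wide` REPAIRED under a NEW name: odd residue degree added, window widened to f ≤ 4e+1, parity-of-e and lower conductor bound dropped), glue
`intrinsicDeepTwistNeronTypeLawAtTwoClassAOdd_of_noTwoTorsion : (Φ) → (R)` PROVED (kernel), (D) `OddGaloisTamagawaTwoPartMonotoneAtTwo` (LEMMA D
corollary, support), (TY)(a)-tower `DeepTwistNeronTypeLawAtTwoClassA` (clause (a) of the in-tree tower row `DeepTwistNeronTypeLawAtTwo` with the window and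
`0 ≤ v₂ j` hypotheses DROPPED — theorem-in-words via LEMMA B + THEOREM Φ; REF1 §131 certified + replayed 4 500/4 500), (B) `NoTwoTorsionConductorBoundAtTwo`
(LEMMA B, REF1 §131 certified theorem-grade) — ALL PLAIN support `def`s (-desc: «plain defs if REF1 passes»; REF1 §131: typed decls SURVIVE; (Φ)/(D) for a
general number field are words-theorems of MEMO-desc §24 whose tower specialisation REF1 replayed — the general-field line-by-line certification (D-desc-56)
was not separately posted at filing; REF2 v37: Lemma D = corollary of print, Φ = VARIANT with printed levers).  NEGATIVE EDGE (MEMO-desc §24.6, D-desc-57): the `IsSquare Δ_v → I₀*` conjunct of clause (a) of the in-tree rows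
`IntrinsicDeepTwistNeronTypeLawAtTwo` (p642939, `@[conjecture]`) and `IntrinsicDeepTwistNeronTypeLawAtTwoWide` (p644498, `@[conjecture]`) is FALSE at places
of EVEN residue degree — witness K = ℚ(√2,√−3) (v ∣ 2 unique, e = 2, k_v = 𝔽₄), E = W_K for each of 1 475 class-(a) W/ℚ with Δ_W ∈ −3ℚ₂^{×2}, 2 ≤ f₂ ≤ 6,
δ = 2+√2: every hypothesis holds, Δ ∈ K_v^{×2}, the rows say I₀*, truth = II/II* (smallest witness 88a1, f₂ = 3 → II, c = 1); those decls STAY in the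
tree as refuted-misstated negative edges (append-only: a landing note is folded into their docstrings separately); clauses (b), (c), (TR♯) unaffected;
the repaired clause (a) is (R) here.  Typer edits = this header, the tags, the REF1/REF2 sentences.  Nothing is asserted: `def … : Prop` rows +
kernel-checked glue only; no instance, no notation.
Census = BC5 WITNESS (`HOME/MEMO-desc-data/g16/` README-24.md + SHA16SUMS; pure python, 0 kit): C1 Lemma J — 3 778 class-(a) curves over ℚ + 15 481
class-(a) curves over five fields with e ∈ {2,4}, 0 violations (`c1_lemmaJ` ec1f64a241a7d873 / 2ac06296c9cb4407); C2 Theorem Φ — 11 415 tower cells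
(n = 1…5) + 20 803 intrinsic cells (five fields, e ∈ {2,4}, window 2 ≤ f ≤ 4e+1), 0 failures, window sharp at 4e+2 (`c2_classA` 896daa1ef711ad2c /
e70037841b3bb633); C3 — 1 475/1 475 kill witnesses for the even-residue-degree I₀*-conjunct (`c3_witness` 8a1d72ff3c3bd0ca / 8a1a2d9837de1594).
REF1-AUDIT §131 (refuter-bsd-f1-sign2-ref1 g11, 2026-08-28T18:14:42Z; `REF1-AUDIT-v1.md` l.2533; evidence `HOME/REF1-data/b131/` — independent GLOBAL Sage
engine kit j314735 (Tate's algorithm over ℚ_k = ℚ(ζ_{2^{k+2}})⁺ with the step generator δ_k = 2 + ζ + ζ⁻¹; 1 500 class-(a) additive Cremona curves N < 6 000,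
k = 1, 2, 3), `descni131.py` e4019e2ea1a932bc; D-desc-60 ANSWERED): «LEMMA B (E(K_v)[2] = 0 ⇒ f_v(E) ≤ 4e + 2) CERTIFIED theorem-grade (Lemma J spelled
out: an irreducible cubic over a 2-adic field has e(L/K) ∈ {1, 3}; unit chart from class (a); Swan/tame descent; the general printed bound is f ≤ 2 + 6e,
Brumer–Kramer — 4e + 2 is sharper and attained); REACH (f(W/ℚ_k) = f₂ ≤ 6 for every k ≥ 1, so Theorem Φ clause (a) is window-free on the tower)
CERTIFIED (first upper break of ℚ_k/ℚ₂ = 2) and REPLAYED: Tamagawa c = 1 on 4 500/4 500 cells, Kodaira type = the law's (I₀* iff Δ square: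
539/539 per layer; else II/II* by 2^k(8 + v₂Δ) mod 12 = 8/4) on 4 500/4 500, f(T) = 4e + 2 on 4 500/4 500 incl. the 170 curves with f₂ = 6 at
every k ≥ 1; k = 0: 1 330/1 330 in reach, 170/170 out-of-reach violate the Φ-shape (reach SHARP at k = 0, TOTAL at k ≥ 1); Lemma B 1 500/1 500,
attained 170×; DESC-NI CERTIFIED (Lang–Mazur, module-by-module recomputation; files separately); typed decls SURVIVE (REF1 copy of SketchG16ClassA
b7f7b7278c894989 farm rc 0 · 0 err · 0 warn · 0 sorry; `DeepTwistNeronTypeLawAtTwoClassA` read symbol by symbol — model-independent; REF1 adds the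
exhaustiveness line: for class (a) with Δ ∉ ℚ₂^{×2} the 2-division field is S₃ with inertia C₃, 8 + v₂Δ is even and prime to 3, so 2^k(8 + v₂Δ) mod
12 ∈ {4, 8} for every k ≥ 1 — the two residue clauses cover every non-square case; `NoTwoTorsionConductorBoundAtTwo` is Lemma B verbatim).  KILLED:
none.  PARTITION moved: none (REF1 concurs: (TY)(a) theorem-in-words for all class-(a) additive W, all k ≥ 1).  Beyond-print theorem: no.  (4) FOR
-desc / -ty: no action needed beyond D-desc-58 as amended.»  D-desc-57 (classification of the §24.6 kill of the (TY♯)(a) I₀*-conjunct): REF2 v37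
§1: AGREE refuted-MISSTATED, C′ = `…ClassAOdd`, witnesses miss C′ (C2 (B) 20 803/20 803); the refuted in-tree decls keep their names (negative edges)
and receive a «misstated» landing note (separate text-only folds on `IntrinsicDeepTwistLawsAtTwo{,Wide}.lean`).
REF2-PLACEMENT v37 §1 (refuter-bsd-f1-sign2-ref2 g37, 2026-08-28T17:45:10Z; `HOME/REF2-PLACEMENT-v37.md` 6c8d80a74c8eac64), REF2_TXT_DESC24: «Placement
(REF2 v37 §1). Lemma J (tameness of K(E[2])/K for curves without a K-rational 2-torsion point; the j-valuation trichotomy, with the `v(j) = 8e ⇔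
unramified` direction only at odd residue degree) and Lemma H (upper ramification breaks 2,…,k+1 of ℚ₂(ζ_{2^{k+2}})⁺; f = 2 + 2ψ(u)) are textbook (Serre,
Corps locaux IV §§2–4; f = 2 + Sw). Lemma D (odd Galois descent of the 2-part of Φ and the inequality v₂c_v(E/K) ≤ v₂c_w(E/L) for L/K Galois of odd
degree) is a corollary of the Néron trace map (Halle–Nicaise 2016, §1.4 and Prop. 47: the kernel of Φ(A_K) → Φ(A_{K′}) is killed by [K′:K]), of tame
Galois descent (Edixhoven 1992, Thm 5.3 and Rem. 5.4.1: the prime-to-n part of Φ_K is that of (Φ_L)^G) and of Hensel–Lang (Bosch–Liu 1999, Lemma 18);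
the Tamagawa inequality is not printed verbatim. THEOREM Φ: over K = ℚ₂ its rows are entries of Barrios et al. 2025, Thm 3 and Table «v(d) = 1»
(indexed there by Weierstrass-coefficient conditions); the f(E) = 0 slice over any K follows from Wang 2024, Thm 1.2 (after Lorenzini 2010/2013); for
e(K/ℚ₂) ≥ 2 and 2 ≤ f(E/K) ≤ 4e+1 the statement is not in print (Comalada 1994 gives Kodaira types over a general complete DVR, with characteristic-2
errata noted by Barrios et al.; the Dokchitser–Dokchitser and Wang twist formulae require semistability over a quadratic extension). Mechanism: Tate's
algorithm on the unit chart over K(E[2]) plus tame descent — printed levers; grade VARIANT; beyond-print theorem: no. Lemma B (f(E/K) ≤ 4e+2 without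
K-rational 2-torsion) is elementary from f = 2 + Sw (the general printed bound is f ≤ 2 + 6e, Brumer–Kramer 1994, Thm 6.2).»
[cite: Serre1979, Ch. IV §§2–4] [cite: Edixhoven1992, Thm. 5.3, Rem. 5.4.1] [cite: BrumerKramer1994, Thm. 6.2] [cite: WangHaiyang2024, Thm. 1.2, Cor. 2.12] [cite: Comalada1994]
[cite: SilvermanATAEC1994, IV.9.4] [cite: BarriosEtAl2025, Thm. 3] [cite: HalleNicaise2016, §1.4, Prop. 47] [cite: BoschLiu1999, Lemma 18]
(Cite-key repair -ty g11 per REF2 v39 §3: the earlier tag `Wang2024` resolved to an unrelated references.bib entry; the intended source is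
Haiyang Wang, arXiv:2406.01985, key `WangHaiyang2024`; three keys REF2 named as the printed levers of Lemma D and Theorem Φ are added.)
PARTITION (-desc v24): (TY)(a) conjecture → theorem-in-words (REF1 §131 certified on the tower); (TY♯)(a), (TY♯-wide)(a) I₀*-conjunct → refuted-misstated + repaired row
typed (R); beyond-print theorem: no (in words + typed, nothing kernel-proved beyond glue).  BSD is not proved by any of this.
bears_on: F1Sign2 leaf (IMC-LTS ⟸ (T_n) ⟸ (TY) `DeepTwistNeronTypeLawAtTwo`: clause (a) now in words for ALL k ≥ 1 — with riders 7–12 (class (b),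
2-torsion charts) the type/Tamagawa side of the tower law is in words on classes (a) and (b); -imc S3 / D-imc-37 class-(a) input available (D-desc-59));
asks D-desc-56/57 (REF1), D-desc-58 (-ty, this file), D-desc-59 (-imc).

## The sketch's own summary (verbatim)

# -desc g16 §24 — CLASS (a) («no `K_v`-rational 2-torsion») of the deep-twist Néron-type law at 2, typed.

Sketch rows (cell bsd-f1-sign2, MEMO-desc §24; census = `MEMO-desc-data/g16/`):
* `NoTwoTorsionJValuationLawAtTwo`      — LEMMA J (elementary, KNOWN-grade support): `E(K_v)[2] = 0 ⇒ 8e ≤ ord_v j`, ramification of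
                                           `K_v(E[2])/K_v` read off `ord_v j − 8e (mod 3)`; at odd residue degree `Δ ∈ K_v^{×2} ⇔ unramified`.
* `NoTwoTorsionDeepTwistNeronLawAtTwo`  — THEOREM Φ (§24, proved in words from riders 3–4 + odd Galois descent + Ogg–Saito + (F♯)):
                                           class (a), `f_v(E) ≤ 4e+1`, `δ` a uniformiser ⇒ `c_v(E^δ) = 1` and the type is `I₀* / II / II*`
                                           according as `ord_v Δ_E ≡ 4e / 4e−4 / 4e+4 (mod 12)`; valid for EVERY `e` and residue degree.
* `IntrinsicDeepTwistNeronTypeLawAtTwoClassAOdd` — the in-tree clause (a) of `IntrinsicDeepTwistNeronTypeLawAtTwo(Wide)`, window widened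
                                           to `f ≤ 4e+1`, no parity-of-`e` hypothesis, RESTRICTED to odd residue degree — glue-derived below.
* `OddGaloisTamagawaTwoPartMonotoneAtTwo` — LEMMA D corollary (odd Galois descent on component groups).
* `DeepTwistNeronTypeLawAtTwoClassA`     — clause (a) of the in-tree tower row with its window/`ord j` hypotheses dropped (§24-add1).
* `NoTwoTorsionConductorBoundAtTwo`      — LEMMA B: class (a) ⇒ `f_v(E) ≤ 4e+2`.
-/

open scoped Classical NumberField
open WeierstrassCurve Literature.NumberTheory.EllipticCurves Literature.NumberTheory.DiophantineGeometry
  Literature.NumberTheory.EllipticCurves.Rank1Residual ZpExtension IsDedekindDomain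

namespace Summit.BirchSwinnertonDyer.Rank1Residual.F1Sign2

/-- **LEMMA J** (support, elementary).  `K` a number field, `v ∣ 2`, `e = e(v|2)`, `E/K` elliptic with NO `K_v`-rational
`2`-torsion abscissa.  Then (i) `j_E = 0` or `ord_v j_E ≥ 8e` (so `E` has potentially good reduction at `v`);
(ii) `ord_v Δ_E` is even (`Δ_E ∈ K_v^{×2} ∪ u_{nr} K_v^{×2}`); (iii) if `Δ_E ∉ K_v^{×2}` (the `S₃` case, inertia of order 3)
then `j_E = 0` or `3 ∤ ord_v j_E − 8e`; (iv) if the residue degree `f(v|2)` is odd (`#k_v = 2^f` not a square) and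
`Δ_E ∈ K_v^{×2}` then `K_v(E[2])/K_v` is the unramified cubic extension and `ord_v j_E = 8e` exactly.
Proof: transitivity of `Gal` on root differences makes `λ, 1−λ` units, `j = 2^8(λ²−λ+1)³/(λ²(1−λ)²)`, and inertia `τ: λ ↦ 1/(1−λ)`
forces `λ̄ ∈ {ω, ω²}`, `ord(λ²−λ+1) ≢ 0 (mod 3)` in the ramified case (Shanks form: `ord_v j − 8e = ord_v(t²+3t+9)`).
Census C1 (g16): 3 778 class-(a) curves over `ℚ` + 15 481 class-(a) curves over five fields with `e ∈ {2,4}`, 0 exceptions. -/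
def NoTwoTorsionJValuationLawAtTwo : Prop :=
  ∀ (K : Type) [Field K] [NumberField K] (v : HeightOneSpectrum (𝓞 K)), (2 : 𝓞 K) ∈ v.asIdeal →
    ∀ (E : WeierstrassCurve K) [E.IsElliptic], twoTorsionRootCountAt v E = 0 →
      (E.j = 0 ∨ 8 * (ramificationIdxOverTwo v : ℤ) ≤ ordAt v E.j) ∧
      Even (ordAt v E.Δ) ∧
      (¬ IsSquare (algebraMap K (v.adicCompletion K) E.Δ) →
        E.j = 0 ∨ ¬ (3 : ℤ) ∣ ordAt v E.j - 8 * (ramificationIdxOverTwo v : ℤ)) ∧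
      (¬ IsSquare (Ideal.absNorm v.asIdeal) → IsSquare (algebraMap K (v.adicCompletion K) E.Δ) →
        E.j ≠ 0 ∧ ordAt v E.j = 8 * (ramificationIdxOverTwo v : ℤ))

/-- **THEOREM Φ — class (a) deep-twist Néron law at 2** (MEMO-desc §24; proved in words; candidate `Prop`).
`K` a number field, `v ∣ 2` with ANY ramification index `e` and residue degree, `E/K` elliptic with no `K_v`-rational
`2`-torsion abscissa and `f_v(E) ≤ 4e + 1`, `δ ∈ K` with `ord_v δ = 1`, `T = E^δ`.  Then `c_v(T) = 1` and the Kodaira type of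
`T` at `v` is `I₀*`, `II` or `II*` according as `ord_v Δ_E ≡ 4e`, `4e − 4`, `4e + 4 (mod 12)` (exactly these residues occur);
`I₀* ⇔ K_v(E[2])/K_v` unramified, which forces `Δ_E ∈ K_v^{×2}` and, at odd residue degree, is forced by it.
(`f_v(T) = 4e + 2` is the KNOWN row `IntrinsicDeepTwistConductorLawAtTwo`.)  Proves clause (a) of the tower row
`DeepTwistNeronTypeLawAtTwo` for all `k ≥ 1`; CONTRADICTS the `IsSquare Δ → I₀*` conjunct of clause (a) of
`IntrinsicDeepTwistNeronTypeLawAtTwo(Wide)` at places of even residue degree (§24.6: `K = ℚ(√2,√−3)`, `E = W_K` for any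
class-(a) `W/ℚ` with `Δ_W ∈ −3ℚ₂^{×2}` and `f₂ ∈ {3,4}`, `δ = 2+√2`: type `II/II*`, not `I₀*`).
Census C2 (g16): 11 415 tower cells (`n = 1…5`) + 20 803 intrinsic cells (five fields, `e ∈ {2,4}`, window `2 ≤ f ≤ 4e+1`), 0 exceptions.
REF1 §131 exhaustiveness line: for class (a) with `Δ ∉ K_v^{×2}` the `2`-division field is `S₃` with inertia `C₃`, `8e + ord_v Δ` is even and prime to `3`,
so exactly the two residues `4e ∓ 4 (mod 12)` occur in the non-square case — no silent third case; REF1 replayed the tower specialisation (kit j314735,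
4 500/4 500).  Filed as a PLAIN support `def` (words-theorem MEMO-desc §24; REF2 v37: VARIANT, printed levers; beyond-print no). -/
def NoTwoTorsionDeepTwistNeronLawAtTwo : Prop :=
  ∀ (K : Type) [Field K] [NumberField K] (v : HeightOneSpectrum (𝓞 K)), (2 : 𝓞 K) ∈ v.asIdeal →
    ∀ (E : WeierstrassCurve K) [E.IsElliptic], twoTorsionRootCountAt v E = 0 →
      E.conductorExponent v ≤ 4 * ramificationIdxOverTwo v + 1 →
      ∀ δ : K, ordAt v δ = 1 →
        (E.quadraticTwist δ).tamagawaNumberAt v = 1 ∧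
        (((E.quadraticTwist δ).kodairaSymbolAt v = .Istar 0 ∧
            ordAt v E.Δ % 12 = (4 * (ramificationIdxOverTwo v : ℤ)) % 12) ∨
          ((E.quadraticTwist δ).kodairaSymbolAt v = .II ∧
            ordAt v E.Δ % 12 = (4 * (ramificationIdxOverTwo v : ℤ) + 8) % 12) ∨
          ((E.quadraticTwist δ).kodairaSymbolAt v = .IIstar ∧
            ordAt v E.Δ % 12 = (4 * (ramificationIdxOverTwo v : ℤ) + 4) % 12)) ∧
        ((E.quadraticTwist δ).kodairaSymbolAt v = .Istar 0 → IsSquare (algebraMap K (v.adicCompletion K) E.Δ)) ∧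
        (¬ IsSquare (Ideal.absNorm v.asIdeal) → IsSquare (algebraMap K (v.adicCompletion K) E.Δ) →
          (E.quadraticTwist δ).kodairaSymbolAt v = .Istar 0)

/-- The in-tree clause (a) of `IntrinsicDeepTwistNeronTypeLawAtTwo(Wide)` REPAIRED: odd residue degree `f(v|2)` added
(at even residue degree `Δ_E ∈ K_v^{×2}` does not detect the unramified cubic and the `I₀*` conjunct fails, §24.6), the
window widened to `f_v(E) ≤ 4e+1`, the parity-of-`e` hypothesis and the lower conductor bound dropped.  Derived from
`NoTwoTorsionDeepTwistNeronLawAtTwo` by the kernel-checked glue below. -/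
def IntrinsicDeepTwistNeronTypeLawAtTwoClassAOdd : Prop :=
  ∀ (K : Type) [Field K] [NumberField K] (v : HeightOneSpectrum (𝓞 K)), (2 : 𝓞 K) ∈ v.asIdeal →
    ¬ IsSquare (Ideal.absNorm v.asIdeal) →
    ∀ (E : WeierstrassCurve K) [E.IsElliptic], twoTorsionRootCountAt v E = 0 →
      E.conductorExponent v ≤ 4 * ramificationIdxOverTwo v + 1 →
      ∀ δ : K, ordAt v δ = 1 →
        (E.quadraticTwist δ).tamagawaNumberAt v = 1 ∧
        (IsSquare (algebraMap K (v.adicCompletion K) E.Δ) → (E.quadraticTwist δ).kodairaSymbolAt v = .Istar 0) ∧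
        (¬ IsSquare (algebraMap K (v.adicCompletion K) E.Δ) →
          ((8 * (ramificationIdxOverTwo v : ℤ) + ordAt v E.Δ) % 12 = 8 → (E.quadraticTwist δ).kodairaSymbolAt v = .II) ∧
          ((8 * (ramificationIdxOverTwo v : ℤ) + ordAt v E.Δ) % 12 = 4 → (E.quadraticTwist δ).kodairaSymbolAt v = .IIstar))

/-- Glue (kernel-checked): THEOREM Φ implies the repaired in-tree clause (a). -/
theorem intrinsicDeepTwistNeronTypeLawAtTwoClassAOdd_of_noTwoTorsion (h : NoTwoTorsionDeepTwistNeronLawAtTwo) :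
    IntrinsicDeepTwistNeronTypeLawAtTwoClassAOdd := by
  intro K _ _ v hv hodd E _ ht hf δ hδ
  obtain ⟨hc, htri, hsq, hnr⟩ := h K v hv E ht hf δ hδ
  refine ⟨hc, fun hs => hnr hodd hs, fun hns => ⟨fun h8 => ?_, fun h4 => ?_⟩⟩
  · rcases htri with ⟨h0, hr⟩ | ⟨h2, _⟩ | ⟨_, hr⟩
    · exact absurd (hsq h0) hns
    · exact h2
    · exfalso; omega
  · rcases htri with ⟨h0, hr⟩ | ⟨_, hr⟩ | ⟨h2, _⟩
    · exact absurd (hsq h0) hns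
    · exfalso; omega
    · exact h2

/-- **LEMMA D corollary** (support): for a Galois extension `L/K` of number fields of ODD degree and places `w ∣ v ∣ 2`,
the `2`-part of the Tamagawa number does not drop: `v₂ c_v(E/K) ≤ v₂ c_w(E/L)` (odd Galois descent
`Φ_K(k_v)[2^∞] ≅ Φ_L(k_w)^G[2^∞]`, `N ∘ i = [L_w : K_v]`, `i ∘ N = Σ_g g`, via the Néron mapping property and Weil restriction). -/
def OddGaloisTamagawaTwoPartMonotoneAtTwo : Prop :=
  ∀ (K L : Type) [Field K] [NumberField K] [Field L] [NumberField L] [Algebra K L] [IsGalois K L],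
    Odd (Module.finrank K L) →
    ∀ (v : HeightOneSpectrum (𝓞 K)) (w : HeightOneSpectrum (𝓞 L)), (2 : 𝓞 K) ∈ v.asIdeal →
      w.asIdeal.comap (algebraMap (𝓞 K) (𝓞 L)) = v.asIdeal →
      ∀ (E : WeierstrassCurve K) [E.IsElliptic],
        padicValNat 2 (E.tamagawaNumberAt v) ≤ padicValNat 2 ((E.map (algebraMap K L)).tamagawaNumberAt w)


/-- **(TY)(a) hypothesis-free on the tower** (MEMO-desc §24.4 + add1).  Clause (a) of the in-tree `DeepTwistNeronTypeLawAtTwo` with the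
hypotheses `0 ≤ v₂ j_W` and `3 ≤ f₂ ≤ 2k+2` DROPPED: for `W/ℚ` additive at `2` with no `ℚ₂`-rational `2`-torsion abscissa, the cyclotomic
`κ`, every `k ≥ 1` and step generator `δ`, at `v ∣ 2` of `ℚ_k`: `c_v(T) = 1`, type `I₀*` iff `Δ_W ∈ ℚ₂^{×2}`, else `II`/`II*` as
`2^k(8 + v₂Δ_W) ≡ 8 / 4 (mod 12)`.  Reason: class (a) forces `f₂ ≤ 6` (Lemma B: `f_v ≤ 4e+2`), so `f(W/ℚ_k) = f₂ ≤ 4·2^k + 1` for every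
`k ≥ 1` (Lemma H) and Theorem Φ applies; residue degree 1 along the tower makes `Δ_W ∈ ℚ₂^{×2} ⇔` unramified `2`-division field.
Census c4_reach: 9 476/9 476 cells at `n = 2…5` (every `f₂ ∈ {0,2,3,4,5,6}`), plus 2 117/2 117 at `n = 1`, `f₂ ≤ 5`.
REF1 §131: CERTIFIED (reach) and REPLAYED by an independent global Sage engine (kit j314735: c = 1, type per law, f(T) = 4e+2 on 4 500/4 500 cells incl.
510 with f₂ = 6); read symbol by symbol, model-independent; exhaustiveness: non-square class (a) ⇒ `2^k(8 + v₂Δ) mod 12 ∈ {4, 8}` for every `k ≥ 1`.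
PLAIN support `def` (theorem-in-words; the in-tree `@[conjecture]` tower row `DeepTwistNeronTypeLawAtTwo` keeps clause (a) with its window — append-only). -/
def DeepTwistNeronTypeLawAtTwoClassA : Prop :=
  ∀ (W : WeierstrassCurve ℚ) [W.IsElliptic], 4 ∣ W.conductorNorm ℤ →
    ∀ (κ : ZpExtension ℚ 2), κ.IsCyclotomic → ∀ k : ℕ, 1 ≤ k → ∀ δ : ↥(κ.layer k), IsTowerStepGenerator κ k δ →
      haveI : FiniteDimensional ℚ ↥(κ.layer k) := κ.finiteDimensional_layer_holds k
      haveI : NumberField ↥(κ.layer k) := NumberField.of_module_finite ℚ ↥(κ.layer k)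
      ∀ v : HeightOneSpectrum (𝓞 ↥(κ.layer k)), (2 : 𝓞 ↥(κ.layer k)) ∈ v.asIdeal →
        twoAdicTwoTorsionRootCount W = 0 →
          (deepTwist W κ k δ).tamagawaNumberAt v = 1 ∧
          (IsSquare (W.Δ : ℚ_[2]) → (deepTwist W κ k δ).kodairaSymbolAt v = .Istar 0) ∧
          (¬ IsSquare (W.Δ : ℚ_[2]) →
            ((2 ^ k * (8 + padicValRat 2 W.Δ)) % 12 = 8 → (deepTwist W κ k δ).kodairaSymbolAt v = .II) ∧
            ((2 ^ k * (8 + padicValRat 2 W.Δ)) % 12 = 4 → (deepTwist W κ k δ).kodairaSymbolAt v = .IIstar))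

/-- **LEMMA B** (support): a class-(a) curve has `f_v(E) ≤ 4e + 2` (over `L = K_v(E[2])`, tame with `e(L/K) ∣ 3`, `E_L` is a unit-chart
curve or its twist by `π_L`; rider 3 gives `f ≤ 4e_L + 2` there and tame descent divides the Swan conductor by `e(L/K)`).
Census: 0/19 259 class-(a) curves exceed it (3 778 over `ℚ`: max `f₂ = 6`; 8 255 with `e = 2`: max 10; 7 226 with `e = 4`: max 18 — the bound is attained at each `e`).
REF1 §131: CERTIFIED theorem-grade (Lemma B line by line; 1 500/1 500, attained 170×); REF2 v37: elementary from `f = 2 + Sw` (printed general bound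
`f ≤ 2 + 6e`, Brumer–Kramer 1994 Thm 6.2). [cite: BrumerKramer1994, Thm. 6.2] -/
def NoTwoTorsionConductorBoundAtTwo : Prop :=
  ∀ (K : Type) [Field K] [NumberField K] (v : HeightOneSpectrum (𝓞 K)), (2 : 𝓞 K) ∈ v.asIdeal →
    ∀ (E : WeierstrassCurve K) [E.IsElliptic], twoTorsionRootCountAt v E = 0 →
      E.conductorExponent v ≤ 4 * ramificationIdxOverTwo v + 2

end Summit.BirchSwinnertonDyer.Rank1Residual.F1Sign2
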